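import Summits.QuantumAdvantage.AdviceFreeQNC0.RingFlipMap
import Summits.QuantumAdvantage.AdviceFreeQNC0.RingHardOdd
import Mathlib.Data.Fintype.Pi
import Mathlib.Algebra.BigOperators.Group.Finset.Basic
import HarnessLib

/-!
# Cell qa-qnc0 — the KERNEL FIBRATION of the ring relation (planner qa-qnc0-p1 g19, ROUND-18 §1–§2;
`exp19/Sketch19.lean` §1–§3, definitions VERBATIM)

For a pattern `x ∈ {0,1}ⁿ` with an odd number of zeros (`IsOdd x`) the ring kernel `K(x)` is the line
`{0, J(x)}` (`RingKernel.kernel_odd`), `J(x) = kline x`.  The FIBRATION picture of `x ↦ J(x)`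
(ROUND-18 §1, F1–F3), for every ring length `n ≥ 3`:

* `kline_hardCore` (F1a) — `J(x)` is HARD-CORE: non-zero, no two cyclically adjacent zeros (two
  adjacent zeros propagate around the cycle by `J_{k+1} = J_{k-1} ⊕ x_k J_k` and force `J = 0`);
* `apply_eq_of_kline` (F1b) — on `supp J` the pattern is forced, `x_k = J_{k-1} ⊕ J_{k+1}`;
  `inKernel_iff_forced` — for a hard-core `v`, `v ∈ K(x)` iff `x` satisfies these forcing equations
  (the bits at the zeros of `v`, the "particles", are FREE COINS); `card_filter_inKernel`:
  `#{x : v ∈ K(x)} = 2^{Z(v)}`, `Z(v)` = number of zeros;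
* `card_fibre` (F1c/F2) — `#{x odd : J(x) = v} = 2^{Z(v)-1}` for hard-core `v` with `Z(v) ≥ 1` (law of
  `J` = hard-core lattice gas with fugacity `2`): one coin flip is an involution switching the parity;
* `card_fibre_coinParity` (F1d/F3) — on the fibre every proper non-empty coin parity is balanced
  (`2^{Z(v)-2}` each side): a two-coin flip, one coin inside the set and one outside (move M1,
  `kline_flipPair`: flipping two coins keeps the odd class and the kernel line);
* `dot2_kline_self` — `⟨J(x), x⟩ ≡ 0`: the stake `b = x` never wins (`even_wtAnd_of_inKernel'`).

Method: the uniqueness principle `kline_eq_iff_inKernel` (an odd pattern's kernel line is the unique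
non-zero kernel vector); `flipAt` parity bookkeeping; cyclic positions as iterates of `nxt`.  The local
moves (hop, creation), the transport identity and the loss/influence lemma: `KernelFibrationMoves.lean`.
Numerics: planner's `exp19/fib_check.py` (n = 7..13, 0 failures).

WHAT THIS IS NOT: no bound for any strategy class; crux 22907 untouched; separation NOT moved.
-/

namespace Summit.QuantumAdvantage.AdviceFreeQNC0.Fib19

open Finset Literature.Computability.QuantumComplexity Literature.Computability.QuantumComplexity.RingHLF

variable {n : ℕ}

/-! ### §1 Objects (Sketch19 §1, verbatim) -/

/-- The kernel line `J(x)` (meaningful on the odd class, `RingKernel.kernel_odd`). -/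
def kline (x : Fin n → Bool) : Fin n → Bool := kernelVec x (fixVec (sigmaSum (List.ofFn x)))

/-- Flip the bits of `x` (or of a kernel vector) on the positions in `S`. -/
def flipAt (x : Fin n → Bool) (S : Finset (Fin n)) : Fin n → Bool := fun i => xor (x i) (decide (i ∈ S))

/-- Number of zeros ("particles") of a vector. -/
def zeros (v : Fin n → Bool) : ℕ := (univ.filter fun i : Fin n => v i = false).card

/-- Hard-core configuration on the cycle: non-zero, no two cyclically adjacent zeros. -/
def HardCore (v : Fin n → Bool) : Prop := (∀ i : Fin n, ¬ (v i = false ∧ v (nxt i) = false)) ∧ ∃ i, v i = true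

/-- The stake of a strategy `z` at `x`: its deviation from the canonical guess `t(x)`. -/
def stake (z : (Fin n → Bool) → (Fin n → Bool)) (x : Fin n → Bool) : Fin n → Bool :=
  fun i => xor (z x i) (tGuess x i)

/-- The odd class, as the tree's `reflBit` flag. -/
def IsOdd (x : Fin n → Bool) : Prop := reflBit (List.ofFn x) = true

/-- `IsOdd` is decidable (it is an equation of booleans). -/
instance (x : Fin n → Bool) : Decidable (IsOdd x) := by unfold IsOdd; infer_instance

/-! ### Cyclic positions -/

/-- The `j`-th cyclic successor of `k` is the position `k + j (mod n)`. -/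
theorem nxt_iterate_val (k : Fin n) : ∀ j : ℕ, ((nxt^[j]) k).val = (k.val + j) % n
  | 0 => by simp [Nat.mod_eq_of_lt k.isLt]
  | j + 1 => by
      rw [Function.iterate_succ_apply']
      show (((nxt^[j]) k).val + 1) % n = _
      rw [nxt_iterate_val k j, Nat.mod_add_mod, Nat.add_assoc]

/-- A proper number of cyclic steps never returns to the start: `nxt^[j] k ≠ k` for `0 < j < n`. -/
theorem nxt_iterate_ne_self (k : Fin n) {j : ℕ} (hj0 : 0 < j) (hjn : j < n) : (nxt^[j]) k ≠ k := by
  intro h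
  have hv := congrArg Fin.val h
  rw [nxt_iterate_val] at hv
  by_cases hlt : k.val + j < n
  · rw [Nat.mod_eq_of_lt hlt] at hv; omega
  · rw [Nat.mod_eq_sub_mod (by omega), Nat.mod_eq_of_lt (by omega)] at hv; omega

/-- Every position is reached from every other by cyclic steps. -/
theorem exists_nxt_iterate (i j : Fin n) : ∃ m : ℕ, (nxt^[m]) i = j := by
  refine ⟨j.val + n - i.val, Fin.ext ?_⟩
  rw [nxt_iterate_val, show i.val + (j.val + n - i.val) = j.val + n from by have := i.isLt; omega,
    Nat.add_mod_right, Nat.mod_eq_of_lt j.isLt]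

/-! ### Hard-core vectors -/

/-- Right neighbour of a zero of a hard-core vector is occupied. -/
theorem HardCore.nxt_eq_true {v : Fin n → Bool} (hv : HardCore v) {i : Fin n} (hi : v i = false) :
    v (nxt i) = true := by
  have h := hv.1 i; rw [hi] at h; simpa using h

/-- Left neighbour of a zero of a hard-core vector is occupied. -/
theorem HardCore.prv_eq_true {v : Fin n → Bool} (hv : HardCore v) {i : Fin n} (hi : v i = false) :
    v (prv i) = true := by
  have h := hv.1 (prv i); rw [nxt_prv, hi] at h; simpa using h

/-- A vector with a `true` coordinate is not the zero vector. -/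
theorem ne_zero_of_apply_eq_true {v : Fin n → Bool} {i : Fin n} (h : v i = true) :
    v ≠ fun _ => false :=
  fun h0 => by rw [h0] at h; exact Bool.false_ne_true h

/-! ### Flips and parities -/

/-- Flipping at a position of `S` negates the bit. -/
theorem flipAt_apply_of_mem {x : Fin n → Bool} {S : Finset (Fin n)} {i : Fin n} (h : i ∈ S) :
    flipAt x S i = !x i := by simp [flipAt, h]

/-- Flipping off `S` does nothing. -/
theorem flipAt_apply_of_not_mem {x : Fin n → Bool} {S : Finset (Fin n)} {i : Fin n} (h : i ∉ S) :
    flipAt x S i = x i := by simp [flipAt, h]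

/-- Flipping twice on the same set is the identity. -/
theorem flipAt_flipAt (x : Fin n → Bool) (S : Finset (Fin n)) : flipAt (flipAt x S) S = x := by
  funext i; unfold flipAt; cases x i <;> cases decide (i ∈ S) <;> rfl

/-- Parity bookkeeping for flips: on any set `S` of positions, the number of `c`-valued bits of
`flipAt x T` and of `x` together have the parity of `|S ∩ T|` (each flipped position in `S`
contributes exactly one, each unflipped one contributes `0` or `2`). -/
theorem card_filter_flipAt_add_mod_two (x : Fin n → Bool) (S T : Finset (Fin n)) (c : Bool) :
    ((S.filter fun i => flipAt x T i = c).card + (S.filter fun i => x i = c).card) % 2 =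
      (S ∩ T).card % 2 := by
  rw [card_filter, card_filter, ← sum_add_distrib, ← filter_mem_eq_inter, card_filter,
    Finset.sum_nat_mod, Finset.sum_congr rfl fun i _ => ?_, ← Finset.sum_nat_mod]
  unfold flipAt
  by_cases hi : i ∈ T
  · simp only [hi, decide_true, Bool.bne_true, if_true]
    cases x i <;> cases c <;> rfl
  · simp only [hi, decide_false, Bool.bne_false, if_false]
    cases x i <;> cases c <;> rfl

/-- The number of zeros changes by `|S| (mod 2)` under the flip on `S`. -/
theorem zeros_flipAt_add_mod_two (x : Fin n → Bool) (S : Finset (Fin n)) :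
    (zeros (flipAt x S) + zeros x) % 2 = S.card % 2 := by
  have h := card_filter_flipAt_add_mod_two x univ S false
  rwa [univ_inter] at h

/-- The odd class: the number of zeros is odd (`RingKernel.reflBit_ofFn_iff`). -/
theorem isOdd_iff (x : Fin n → Bool) : IsOdd x ↔ zeros x % 2 = 1 := by
  unfold IsOdd zeros; rw [reflBit_ofFn_iff, Nat.odd_iff]

/-- `IsOdd` is the crux's `OddZeros` (`RingHardOdd.lean`). -/
theorem isOdd_iff_oddZeros (x : Fin n → Bool) : IsOdd x ↔ OddZeros x := by
  rw [isOdd_iff]; rfl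

/-- The odd class after a flip on `S`. -/
theorem isOdd_flipAt_iff (x : Fin n → Bool) (S : Finset (Fin n)) :
    IsOdd (flipAt x S) ↔ (zeros x + S.card) % 2 = 1 := by
  rw [isOdd_iff]; have h := zeros_flipAt_add_mod_two x S; omega

/-- A flip on an even set keeps the odd class. -/
theorem isOdd_flipAt_of_even (x : Fin n → Bool) (S : Finset (Fin n)) (hS : S.card % 2 = 0) :
    IsOdd (flipAt x S) ↔ IsOdd x := by
  rw [isOdd_flipAt_iff, isOdd_iff]; omega

/-- A flip on an odd set switches the odd and the even class. -/
theorem isOdd_flipAt_of_odd (x : Fin n → Bool) (S : Finset (Fin n)) (hS : S.card % 2 = 1) :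
    IsOdd (flipAt x S) ↔ ¬ IsOdd x := by
  rw [isOdd_flipAt_iff, isOdd_iff]; omega

/-! ### §2 The fibration -/

/-- The kernel line of an odd pattern lies in the kernel (`kernel_odd`). -/
theorem kline_inKernel (hn : 3 ≤ n) (x : Fin n → Bool) (hodd : IsOdd x) : InKernel x (kline x) :=
  (kernel_odd hn x hodd _).2 (Or.inr rfl)

/-- The kernel line of an odd pattern is non-zero (`kernelVec_fixVec_ne_zero`). -/
theorem kline_ne_zero (hn : 3 ≤ n) (x : Fin n → Bool) (hodd : IsOdd x) : kline x ≠ fun _ => false :=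
  kernelVec_fixVec_ne_zero hn x hodd

/-- **Uniqueness principle.** For an odd pattern, a non-zero vector IS the kernel line iff it lies in
the kernel (`K(x) = {0, J(x)}`, `kernel_odd`).  Every "effect of a move on `J`" is proved this way. -/
theorem kline_eq_iff_inKernel (hn : 3 ≤ n) (x : Fin n → Bool) (hodd : IsOdd x) {v : Fin n → Bool}
    (hv : v ≠ fun _ => false) : kline x = v ↔ InKernel x v := by
  constructor
  · rintro rfl; exact kline_inKernel hn x hodd
  · intro h
    rcases (kernel_odd hn x hodd v).1 h with rfl | h'
    · exact absurd rfl hv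
    · exact h'.symm

/-- On the support of the kernel line the pattern is determined: `x_k = J_{k-1} ⊕ J_{k+1}`
(this IS the kernel equation at `k`; planner's F1(b)). -/
theorem apply_eq_of_kline (hn : 3 ≤ n) (x : Fin n → Bool) (hodd : IsOdd x) (k : Fin n)
    (hk : kline x k = true) : x k = xor (kline x (prv k)) (kline x (nxt k)) := by
  have h := kline_inKernel hn x hodd k
  rw [hk, Bool.and_true] at h
  revert h
  cases x k <;> cases kline x (prv k) <;> cases kline x (nxt k) <;> decide

/-- **F1a.** The kernel line of an odd pattern is a hard-core configuration: two adjacent zeros would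
propagate (`J_{k+1} = J_{k-1} ⊕ x_k J_k`) around the cycle to `J = 0`, contradicting
`kernelVec_fixVec_ne_zero`. -/
theorem kline_hardCore (hn : 3 ≤ n) (x : Fin n → Bool) (hodd : IsOdd x) : HardCore (kline x) := by
  have hK := kline_inKernel hn x hodd
  have hne := kline_ne_zero hn x hodd
  refine ⟨fun i hi => hne ?_, ?_⟩
  · have key : ∀ m : ℕ, kline x ((nxt^[m]) i) = false ∧ kline x ((nxt^[m + 1]) i) = false := by
      intro m
      induction m with
      | zero => exact ⟨hi.1, hi.2⟩
      | succ m ih =>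
        refine ⟨ih.2, ?_⟩
        have e := hK ((nxt^[m + 1]) i)
        have hp : prv ((nxt^[m + 1]) i) = (nxt^[m]) i := by
          rw [Function.iterate_succ_apply', prv_nxt]
        have hx : nxt ((nxt^[m + 1]) i) = (nxt^[m + 1 + 1]) i :=
          (Function.iterate_succ_apply' nxt (m + 1) i).symm
        rw [hp, hx, ih.1, ih.2] at e
        simpa using e
    funext j
    obtain ⟨m, hm⟩ := exists_nxt_iterate i j
    rw [← hm]
    exact (key m).1
  · by_contra h
    push Not at h
    exact hne (funext fun i => by simpa using h i)

/-- The bits at zeros of a kernel vector are free: flipping them keeps the vector in the kernel. -/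
theorem inKernel_flipAt_iff (x v : Fin n → Bool) (S : Finset (Fin n)) (hS : ∀ i ∈ S, v i = false) :
    InKernel (flipAt x S) v ↔ InKernel x v := by
  unfold InKernel
  refine forall_congr' fun b => ?_
  by_cases hb : b ∈ S
  · rw [hS b hb, Bool.and_false, Bool.and_false]
  · rw [flipAt_apply_of_not_mem hb]

/-- **F1b/F1c as an equivalence.** For a vector `v` without two adjacent zeros, `v ∈ K(x)` iff the
pattern satisfies the forcing equations `x_b = v_{b-1} ⊕ v_{b+1}` on `supp v` (at a zero of `v` the
kernel equation holds automatically: both neighbours are occupied). -/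
theorem inKernel_iff_forced (v : Fin n → Bool) (hv : ∀ i : Fin n, ¬ (v i = false ∧ v (nxt i) = false))
    (x : Fin n → Bool) : InKernel x v ↔ ∀ b, v b = true → x b = xor (v (prv b)) (v (nxt b)) := by
  unfold InKernel
  refine forall_congr' fun b => ?_
  cases hb : v b
  · have h1 : v (nxt b) = true := by have h := hv b; rw [hb] at h; simpa using h
    have h2 : v (prv b) = true := by have h := hv (prv b); rw [nxt_prv, hb] at h; simpa using h
    rw [h1, h2]
    simp
  · constructor
    · intro h _
      revert h
      cases x b <;> cases v (prv b) <;> cases v (nxt b) <;> decide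
    · intro h
      rw [h rfl]
      cases v (prv b) <;> cases v (nxt b) <;> decide

/-- `#{x : v ∈ K(x)} = 2^{Z(v)}` for `v` without two adjacent zeros: the forced bits on `supp v`,
free coins at the zeros (`Fintype.card_piFinset`). -/
theorem card_filter_inKernel (v : Fin n → Bool) (hv : ∀ i : Fin n, ¬ (v i = false ∧ v (nxt i) = false)) :
    (univ.filter fun x : Fin n → Bool => InKernel x v).card = 2 ^ zeros v := by
  classical
  have hset : (univ.filter fun x : Fin n → Bool => InKernel x v) =
      Fintype.piFinset fun b => if v b = true then {xor (v (prv b)) (v (nxt b))} else univ := by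
    ext x
    rw [mem_filter, Fintype.mem_piFinset, inKernel_iff_forced v hv]
    simp only [mem_univ, true_and]
    refine forall_congr' fun b => ?_
    by_cases hb : v b = true
    · rw [if_pos hb]; simp [hb]
    · rw [if_neg hb]; simp [hb]
  rw [hset, Fintype.card_piFinset]
  have hfac : ∀ b : Fin n,
      (if v b = true then ({xor (v (prv b)) (v (nxt b))} : Finset Bool) else univ).card =
        2 ^ (if v b = false then 1 else 0) := by
    intro b; cases v b <;> simp
  rw [Finset.prod_congr rfl fun b _ => hfac b, Finset.prod_pow_eq_pow_sum, ← card_filter]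
  rfl

/-- Halving by an involution: if `σ` is an involution of `A` switching `P` and `¬P`, then `P` holds on
exactly half of `A`. -/
theorem two_mul_card_filter_of_invol {α : Type*} (A : Finset α) (P : α → Prop) [DecidablePred P]
    (σ : α → α) (hA : ∀ a ∈ A, σ a ∈ A) (hσ : ∀ a ∈ A, σ (σ a) = a)
    (hP : ∀ a ∈ A, (P (σ a) ↔ ¬ P a)) : 2 * (A.filter P).card = A.card := by
  have h : (A.filter P).card = (A.filter fun a => ¬ P a).card := by
    refine card_bij' (fun a _ => σ a) (fun a _ => σ a) (fun a ha => ?_) (fun a ha => ?_)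
      (fun a ha => hσ a (mem_filter.1 ha).1) (fun a ha => hσ a (mem_filter.1 ha).1)
    · rw [mem_filter] at ha ⊢
      exact ⟨hA a ha.1, fun h => (hP a ha.1).1 h ha.2⟩
    · rw [mem_filter] at ha ⊢
      exact ⟨hA a ha.1, (hP a ha.1).2 ha.2⟩
  have h2 := Finset.card_filter_add_card_filter_not (s := A) P
  omega

/-- **M1 (coin-pair flip).** Flipping two coins (bits at two zeros of `J`) keeps the odd class and
the kernel line. -/
theorem kline_flipPair (hn : 3 ≤ n) (x : Fin n → Bool) (hodd : IsOdd x) {k k' : Fin n} (hkk : k ≠ k')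
    (hk : kline x k = false) (hk' : kline x k' = false) :
    IsOdd (flipAt x {k, k'}) ∧ kline (flipAt x {k, k'}) = kline x := by
  have hodd' : IsOdd (flipAt x {k, k'}) :=
    (isOdd_flipAt_of_even x _ (by rw [card_pair hkk])).2 hodd
  refine ⟨hodd', (kline_eq_iff_inKernel hn _ hodd' (kline_ne_zero hn x hodd)).2 ?_⟩
  refine (inKernel_flipAt_iff x (kline x) {k, k'} fun i hi => ?_).2 (kline_inKernel hn x hodd)
  rw [mem_insert, mem_singleton] at hi
  rcases hi with rfl | rfl
  · exact hk
  · exact hk'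

/-- **F1c / F2 (fibre count = the law of `J` is the hard-core gas with fugacity 2).** For a hard-core
`v` with at least one zero, exactly `2^{Z(v)-1}` odd patterns have kernel line `v` (the bits on
`supp v` are forced, the `Z(v)` coins are free up to one global parity). -/
theorem card_fibre (hn : 3 ≤ n) (v : Fin n → Bool) (hv : HardCore v) (hz : 0 < zeros v) :
    (univ.filter fun x : Fin n → Bool => IsOdd x ∧ kline x = v).card = 2 ^ (zeros v - 1) := by
  classical
  obtain ⟨i₀, hi₀⟩ : ∃ i₀, v i₀ = false := by
    obtain ⟨i, hi⟩ := Finset.card_pos.1 hz; exact ⟨i, (mem_filter.1 hi).2⟩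
  obtain ⟨i₁, hi₁⟩ := hv.2
  have hv0 : v ≠ fun _ => false := ne_zero_of_apply_eq_true hi₁
  have hset : (univ.filter fun x : Fin n → Bool => IsOdd x ∧ kline x = v) =
      (univ.filter fun x : Fin n → Bool => InKernel x v).filter IsOdd := by
    ext x
    simp only [mem_filter, mem_univ, true_and]
    constructor
    · rintro ⟨ho, hk⟩; exact ⟨(kline_eq_iff_inKernel hn x ho hv0).1 hk, ho⟩
    · rintro ⟨hk, ho⟩; exact ⟨ho, (kline_eq_iff_inKernel hn x ho hv0).2 hk⟩
  have hhalf := two_mul_card_filter_of_invol (univ.filter fun x : Fin n → Bool => InKernel x v) IsOdd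
    (fun x => flipAt x {i₀}) (fun x hx => ?_) (fun x _ => flipAt_flipAt x _) (fun x _ => ?_)
  · rw [card_filter_inKernel v hv.1] at hhalf
    rw [hset]
    obtain ⟨z, hz'⟩ : ∃ z, zeros v = z + 1 := ⟨zeros v - 1, by omega⟩
    rw [hz', pow_succ] at hhalf
    rw [hz', Nat.add_sub_cancel]
    omega
  · rw [mem_filter] at hx ⊢
    refine ⟨mem_univ _, (inKernel_flipAt_iff x v {i₀} fun i hi => ?_).2 hx.2⟩
    rw [mem_singleton] at hi; rw [hi]; exact hi₀
  · exact isOdd_flipAt_of_odd x {i₀} (by rw [card_singleton])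

/-- **F1d / F3 (the coins are uniform on a parity class).** For a hard-core `v` and a set `S` of zeros
of `v` that is neither empty nor all zeros, the parity `⊕_{i ∈ S} x_i` is balanced on the fibre of `v`:
each value is taken by `2^{Z(v)-2}` odd patterns (a two-coin flip, one coin in `S` and one outside,
is an involution of the fibre switching the parity — M1). -/
theorem card_fibre_coinParity (hn : 3 ≤ n) (v : Fin n → Bool) (hv : HardCore v)
    (S : Finset (Fin n)) (hS : ∀ i ∈ S, v i = false) (hne : S.Nonempty)
    (hprop : ∃ i, v i = false ∧ i ∉ S) :
    (univ.filter fun x : Fin n → Bool => IsOdd x ∧ kline x = v ∧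
        (S.filter fun i => x i = true).card % 2 = 1).card = 2 ^ (zeros v - 2) := by
  classical
  obtain ⟨i₁, hi₁⟩ := hne
  obtain ⟨i₂, hi₂, hi₂S⟩ := hprop
  have h12 : i₁ ≠ i₂ := fun h => hi₂S (h ▸ hi₁)
  have hz2 : 2 ≤ zeros v := by
    unfold zeros
    calc 2 = ({i₁, i₂} : Finset (Fin n)).card := (card_pair h12).symm
      _ ≤ _ := card_le_card fun i hi => by
          rw [mem_insert, mem_singleton] at hi
          rw [mem_filter]
          rcases hi with rfl | rfl
          · exact ⟨mem_univ _, hS _ hi₁⟩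
          · exact ⟨mem_univ _, hi₂⟩
  have hset : (univ.filter fun x : Fin n → Bool => IsOdd x ∧ kline x = v ∧
      (S.filter fun i => x i = true).card % 2 = 1) =
      (univ.filter fun x : Fin n → Bool => IsOdd x ∧ kline x = v).filter
        fun x => (S.filter fun i => x i = true).card % 2 = 1 := by
    ext x
    simp only [mem_filter, mem_univ, true_and, and_assoc]
  have hhalf := two_mul_card_filter_of_invol (univ.filter fun x : Fin n → Bool => IsOdd x ∧ kline x = v)
    (fun x => (S.filter fun i => x i = true).card % 2 = 1)
    (fun x => flipAt x {i₁, i₂}) (fun x hx => ?_) (fun x _ => flipAt_flipAt x _) (fun x _ => ?_)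
  · rw [card_fibre hn v hv (by omega)] at hhalf
    rw [hset]
    obtain ⟨z, hz'⟩ : ∃ z, zeros v = z + 2 := ⟨zeros v - 2, by omega⟩
    rw [hz', show z + 2 - 1 = z + 1 from rfl, pow_succ] at hhalf
    rw [hz', Nat.add_sub_cancel]
    omega
  · simp only [mem_filter, mem_univ, true_and] at hx ⊢
    obtain ⟨ho, hk⟩ := hx
    have hM := kline_flipPair hn x ho h12 (by rw [hk]; exact hS _ hi₁) (by rw [hk]; exact hi₂)
    exact ⟨hM.1, hM.2.trans hk⟩
  · have h := card_filter_flipAt_add_mod_two x S {i₁, i₂} true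
    have hI : S ∩ {i₁, i₂} = {i₁} := by
      ext i
      simp only [mem_inter, mem_insert, mem_singleton]
      constructor
      · rintro ⟨hi, rfl | rfl⟩
        · rfl
        · exact absurd hi hi₂S
      · rintro rfl; exact ⟨hi₁, Or.inl rfl⟩
    rw [hI, card_singleton] at h
    omega

/-- **`⟨J(x), x⟩ ≡ 0`**: the pattern never wins against itself (the stake `b = x` always loses;
`|x ∧ v|` is even for every kernel vector, `RingCanonical.even_wtAnd_of_inKernel'`). -/
theorem dot2_kline_self (hn : 3 ≤ n) (x : Fin n → Bool) (hodd : IsOdd x) : dot2 (kline x) x = 0 := by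
  obtain ⟨c, hc⟩ := even_wtAnd_of_inKernel' hn (kline_inKernel hn x hodd)
  unfold wtAnd at hc
  unfold dot2
  rw [show (univ.filter fun b : Fin n => kline x b = true ∧ x b = true) =
      univ.filter fun b : Fin n => x b = true ∧ kline x b = true from filter_congr fun b _ => and_comm, hc]
  omega

end Summit.QuantumAdvantage.AdviceFreeQNC0.Fib19
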